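import Literature.AnabelianGeometry.EtaleTheta.SettingModelTateSemidirect
import Literature.AnabelianGeometry.EtaleTheta.SettingModelCuspAxis
import Literature.AnabelianGeometry.EtaleTheta.GalSectCuspPairTorsors
import HarnessLib

/-!
# The STAGE-2 («Tate shear») model of the [EtTh] §1 root, file F4qc: a CUSP DATUM for `curveχq` — `curveχq′`

Mochizuki, *The étale theta function …*, Publ. RIMS **45** (2009) [EtTh], §1 pp. 11–13 [cite: MochizukiEtTh2009, §1 p.13]
("any decomposition group of a cusp of `Y^log`"); Mochizuki, *Semi-graphs of anabelioids* [SemiAnbd], §6 p. 71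
("`I_x` is isomorphic to `Ẑ(1)` if `x` is a cusp") [cite: MochizukiSemiAnbd2006, §6 p.71].

Cell abc-iut, layer L2, R78 cluster STAGE 2 (integrator abc-iut-L6-d6 R78-MAP #5/#9: `modelχq`, the affine action
`θ_σ : a ↦ a·b^{k(σ)}·c^{m(σ)}, b ↦ b^{χ(σ)}`; F4q = abc-iut-w5-d249's `SettingModelTateSemidirect`, p432710 ✓:
`PiTpχq p i j = Γ ⋊[actχq p i j] G_{ℚ_p}`, `curveχq p i j` with no closed point).  This file is the stage-2 clone of
this seat's F4c (`SettingModelChiCusp`, p429840): the affine action STILL STABILISES the `b`-axis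
(`affTwist₃ ⟨(m,k),α⟩ (b^t) = Inn(b^m)(shear k (θ_α b^t)) = b^{α t}` by F2's `twist_bPow`, L2-t6's `shear_bPow`,
`innB_bPow`), so `SettingModelCuspAxis.cuspDecomp` applies verbatim:

* `actHatχq_bPow`, `actχq_bPowGfp`, `actχq_stabilises` — χ-stability of the axis under the affine action;
* `cuspDecompχq p i j : Subgroup (PiTpχq p i j)` (`= b^Ẑ ⋊ G_{ℚ_p}`), closed, `aug`-image all of `G_{ℚ_p}`,
  inertia `inl(b^Ẑ) ≃ₜ* Ẑ` (`inertiaEquivχq`), `gfpSnd ∘ left = 1` on it ((P3)-shape);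
* **`curveχq′ p i j : TemperedCurve p`** — `curveχq` with `Pt := Unit`, `IsCusp := ⊤`, `decomp := cuspDecompχq`
  (same carriers), `exists_isCusp_curveχq′`, `map_aug_decomp_curveχq′` ((P4)), `gfpSnd_left_eq_one_of_mem_decomp_curveχq′`,
  `isCuspidalDecompositionGroup_cuspDecompχq`, `inrSplittingχq` (the canonical section is a splitting, so this
  seat's `TemperedCurve.cuspTorsorH1` — p432116 — applies here too).

HONEST LABEL (as for F4c): synthetic cusp — inertia := the Tate-twisted procyclic axis `b^Ẑ`, not print's
boundary-commutator axis; clauses that READ `Π^tp_{Y_N}` off a cusp section (`GtpYNFromCusp`) are not served by it.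
Semi-synthetic model, consistency evidence only; [EtTh]/[SemiAnbd] refereed; typed ≠ proved; no side taken on
[IUTchIII] Cor. 3.12.  Post-freeze class (b) construction; no instance, no Prop fact; F4q untouched.

APPENDED (abc-iut-w5-d249 gen 5, append protocol — every declaration above byte-identical to abc-iut-w5-d029's p434515;
this block RESTORES p434515 after w5-d249's parallel whole-file p434880 of the same basename had replaced it, and adds the
extras of that file): `affTwist₃Gfp_bPowGfp` / `affTwist₃Gfp_mem_bAxisGfp` (the `Γ`-level axis law for ANY element of
`(Ẑ × Ẑ) ⋊ Ẑ^×`, input of the stage-2 inversion `SettingModelTateInversion`), the `rfl` transfers `curveχq′_aug/_toHat/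
_deltaTemp`, `isTempered_piTemp_curveχq′`, `isFreeProfiniteOnTwo_deltaHat_curveχq′`, `isCusp_curveχq′`, `nonempty_pt_curveχq′`.
-/

noncomputable section

namespace Literature.AnabelianGeometry.EtaleTheta.SettingModel

open Literature.AnabelianGeometry.SemiGraphs _root_.Topology _root_.Function
open scoped Pointwise

variable (p : ℕ) [Fact p.Prime] (i j : ℤ)

/-! ### The affine action stabilises the `b`-axis -/

/-- `affTwist₃ g (b^t) = b^{g.right t}`: inner `b`-powers and shears FIX `b^Ẑ`, the twist acts through `Ẑ^×`.
[cite: MochizukiEtTh2009, §1 p.12] -/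
theorem affTwist₃_bPow (g : (ZH × ZH) ⋊[diagAut] MulAut ZH) (t : ZH) : affTwist₃ g (bPow t) = bPow (g.right t) := by
  rw [affTwist₃_apply, twist_bPow, shear_bPow, innB_bPow]

/-- `actHatχq σ (b^t) = b^{χ-part(σ) t}`. [cite: MochizukiEtTh2009, §1 p.12] -/
theorem actHatχq_bPow (σ : GQp p) (t : ZH) :
    actHatχq p i j σ (bPow t) = bPow ((tatePairHom p i j σ).right t) :=
  affTwist₃_bPow _ t

/-- `actχq σ (b^t, 0) = (b^{…}, 0)` in `Γ`. [cite: MochizukiEtTh2009, §1 p.12] -/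
theorem actχq_bPowGfp (σ : GQp p) (t : ZH) :
    actχq p i j σ (bPowGfp t) = bPowGfp ((tatePairHom p i j σ).right t) :=
  Subtype.ext (Prod.ext (by
    change gfpFst (actχq p i j σ (bPowGfp t)) = bPow ((tatePairHom p i j σ).right t)
    rw [gfpFst_actχq, gfpFst_bPowGfp, actHatχq_bPow]) (by
    change gfpSnd (actχq p i j σ (bPowGfp t)) = gfpSnd (bPowGfp ((tatePairHom p i j σ).right t))
    rw [gfpSnd_actχq, gfpSnd_bPowGfp, gfpSnd_bPowGfp]))

/-- The affine action stabilises the `b`-axis of `Γ`. [cite: MochizukiEtTh2009, §1 p.12] -/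
theorem actχq_stabilises (σ : GQp p) {q : Gfp} (hq : q ∈ bAxisGfp) : actχq p i j σ q ∈ bAxisGfp := by
  obtain ⟨t, rfl⟩ := hq
  exact ⟨_, (actχq_bPowGfp p i j σ t).symm⟩

/-! ### The cusp decomposition group `b^Ẑ ⋊ G_{ℚ_p} ≤ Π^tp_X` (stage 2) -/

/-- **The decomposition group of the cusp** at stage 2. [cite: MochizukiEtTh2009, §1 p.13] -/
def cuspDecompχq : Subgroup (PiTpχq p i j) := cuspDecomp (actχq p i j) (actχq_stabilises p i j)

/-- [cite: MochizukiEtTh2009, §1 p.13] -/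
theorem mem_cuspDecompχq_iff (g : PiTpχq p i j) : g ∈ cuspDecompχq p i j ↔ g.left ∈ bAxisGfp := Iff.rfl

/-- `D` is closed. [cite: MochizukiSemiAnbd2006, §6 p.71] -/
theorem isClosed_cuspDecompχq : IsClosed (cuspDecompχq p i j : Set (PiTpχq p i j)) :=
  isClosed_cuspDecomp (actχq p i j) (actχq_stabilises p i j) (Semidirect.continuous_left (isInducing_leftRightχq p i j))

/-- `aug(D) = G_{ℚ_p}`. [cite: MochizukiSemiAnbd2006, §6 p.71] -/
theorem augχq_image_cuspDecompχq : (augχq p i j) '' (cuspDecompχq p i j : Set (PiTpχq p i j)) = Set.univ :=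
  rightHom_image_cuspDecomp (actχq p i j) (actχq_stabilises p i j)

/-- Hence open. [cite: MochizukiSemiAnbd2006, §6 p.71] -/
theorem isOpen_augχq_image_cuspDecompχq : IsOpen ((augχq p i j) '' (cuspDecompχq p i j : Set (PiTpχq p i j))) := by
  rw [augχq_image_cuspDecompχq]
  exact isOpen_univ

/-- `map aug D = ⊤`. [cite: MochizukiEtTh2009, §1 p.13] -/
theorem map_augχq_cuspDecompχq : (cuspDecompχq p i j).map (augχq p i j).toMonoidHom = ⊤ :=
  map_rightHom_cuspDecomp (actχq p i j) (actχq_stabilises p i j)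

/-- The inertia `D ∩ Ker(aug) = inl(b^Ẑ)`. [cite: MochizukiSemiAnbd2006, §6 p.71] -/
theorem cuspDecompχq_inf_ker :
    cuspDecompχq p i j ⊓ (augχq p i j).toMonoidHom.ker = bAxisGfp.map (SemidirectProduct.inl : Gfp →* PiTpχq p i j) :=
  cuspDecomp_inf_ker_rightHom (actχq p i j) (actχq_stabilises p i j)

/-- `I ≃ₜ* Ẑ`. [cite: MochizukiSemiAnbd2006, §6 p.71] -/
def inertiaEquivχq : ↥(cuspDecompχq p i j ⊓ (augχq p i j).toMonoidHom.ker) ≃ₜ* ZHat :=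
  inertiaEquiv (actχq p i j) (actχq_stabilises p i j) (Semidirect.continuous_left (isInducing_leftRightχq p i j))
    (continuous_inlχq p i j)

/-- [cite: MochizukiSemiAnbd2006, §6 p.71] -/
theorem nonempty_inertiaEquivχq : Nonempty (↥(cuspDecompχq p i j ⊓ (augχq p i j).toMonoidHom.ker) ≃ₜ* ZHat) :=
  ⟨inertiaEquivχq p i j⟩

/-- (P3)-shape: the degree `pr₂ ∘ left` vanishes on `D`. [cite: MochizukiEtTh2009, §1 p.13] -/
theorem gfpSnd_left_eq_one_of_mem_cuspDecompχq {g : PiTpχq p i j} (hg : g ∈ cuspDecompχq p i j) : gfpSnd g.left = 1 :=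
  gfpSnd_left_eq_one_of_mem_cuspDecomp (actχq p i j) (actχq_stabilises p i j) hg

/-! ### `curveχq′`: the stage-2 model WITH a cusp -/

/-- **The stage-2 tempered-curve layer WITH ONE CUSP**: `curveχq p i j` with `Pt := Unit`, the point a cusp,
`D_x := b^Ẑ ⋊ G_{ℚ_p}` (additive variant; synthetic cusp). [cite: MochizukiSemiAnbd2006, §6 p.71] -/
abbrev curveχq' : TemperedCurve p where
  K := (curveχq p i j).K
  finiteDimensional_K := (curveχq p i j).finiteDimensional_K
  PiTemp := PiTpχq p i j
  aug := augχq p i j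
  range_aug := (curveχq p i j).range_aug
  PiHat := PiHtχq p i j
  toHat := toHatχq p i j
  isProfiniteCompletion_toHat := isProfiniteCompletion_toHatχq p i j
  toHat_injective := toHatχq_injective p i j
  augHat := augHatχq p i j
  augHat_comp := (curveχq p i j).augHat_comp
  Pt := Unit
  IsCusp _ := True
  decomp _ := cuspDecompχq p i j
  isClosed_decomp _ := isClosed_cuspDecompχq p i j
  isOpen_aug_decomp _ := isOpen_augχq_image_cuspDecompχq p i j
  inertia_eq_bot _ h := (h trivial).elim
  inertia_equiv_zHat _ _ := nonempty_inertiaEquivχq p i j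

/-- `curveχq′` and `curveχq` share `Π^tp_X`. [cite: MochizukiEtTh2009, §1 p.12] -/
theorem curveχq'_PiTemp : (curveχq' p i j).PiTemp = (curveχq p i j).PiTemp := rfl

/-- … and `Δ_X`. [cite: MochizukiEtTh2009, §1 p.12] -/
theorem curveχq'_deltaHat : (curveχq' p i j).DeltaHat = (curveχq p i j).DeltaHat := rfl

/-- (P2): there is a cusp. [cite: MochizukiEtTh2009, §1 p.12] -/
theorem exists_isCusp_curveχq' : ∃ x : (curveχq' p i j).Pt, (curveχq' p i j).IsCusp x := ⟨(), trivial⟩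

/-- The decomposition group of the cusp. [cite: MochizukiEtTh2009, §1 p.13] -/
theorem decomp_curveχq' (x : (curveχq' p i j).Pt) : (curveχq' p i j).decomp x = cuspDecompχq p i j := rfl

/-- Its inertia is `inl(b^Ẑ)`. [cite: MochizukiSemiAnbd2006, §6 p.71] -/
theorem inertia_curveχq'_eq (x : (curveχq' p i j).Pt) :
    (curveχq' p i j).inertia x = bAxisGfp.map (SemidirectProduct.inl : Gfp →* PiTpχq p i j) :=
  cuspDecompχq_inf_ker p i j

/-- (P4): `D_x ↠ G_K` (`= G_{ℚ_p}`). [cite: MochizukiEtTh2009, §1 p.13] -/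
theorem map_aug_decomp_curveχq' (x : (curveχq' p i j).Pt) :
    ((curveχq' p i j).decomp x).map (curveχq' p i j).aug.toMonoidHom = (curveχq' p i j).GK := by
  change (cuspDecompχq p i j).map (augχq p i j).toMonoidHom = (⊥ : IntermediateField ℚ_[p] _).fixingSubgroup
  rw [map_augχq_cuspDecompχq, IntermediateField.fixingSubgroup_bot]

/-- (P3)-shape at `curveχq′`. [cite: MochizukiEtTh2009, §1 p.13] -/
theorem gfpSnd_left_eq_one_of_mem_decomp_curveχq' (x : (curveχq' p i j).Pt) {g : PiTpχq p i j}
    (hg : g ∈ (curveχq' p i j).decomp x) : gfpSnd g.left = 1 :=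
  gfpSnd_left_eq_one_of_mem_cuspDecompχq p i j hg

/-- `b^Ẑ ⋊ G_{ℚ_p}` IS a cuspidal decomposition group of `curveχq′`. [cite: MochizukiSemiAnbd2006, §6 p.71] -/
theorem isCuspidalDecompositionGroup_cuspDecompχq :
    (curveχq' p i j).IsCuspidalDecompositionGroup (cuspDecompχq p i j) :=
  ⟨(), trivial, 1, by rw [one_smul]⟩

/-- `Π^tp_X` (stage 2) is Hausdorff. [cite: MochizukiEtTh2009, §1 p.12] -/
theorem t2Space_PiTpχq : T2Space (PiTpχq p i j) := Semidirect.t2Space_of (isInducing_leftRightχq p i j)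

/-- **The canonical section `G_{ℚ_p} ↪ b^Ẑ ⋊ G_{ℚ_p}` is a SPLITTING of the stage-2 cusp** (so
`TemperedCurve.cuspTorsorH1`, p432116, applies: the splitting classes form a torsor over `Ker(res)`).
[cite: MochizukiGalSect2005, §4 p.33] -/
theorem inrSplittingχq :
    (SemidirectProduct.inr : GQp p →* PiTpχq p i j).range ∈ (GalSect.cuspPairOf (curveχq' p i j) ()).splittings := by
  haveI := t2Space_PiTpχq p i j
  have hrange : ((SemidirectProduct.inr : GQp p →* PiTpχq p i j).range : Set (PiTpχq p i j)) =
      (fun g : PiTpχq p i j => g.left) ⁻¹' {1} := by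
    ext g
    constructor
    · rintro ⟨σ, rfl⟩; exact SemidirectProduct.left_inr σ
    · intro hg
      exact ⟨g.right, SemidirectProduct.ext (by simpa using hg.symm) (by simp)⟩
  refine ⟨?_, ?_, ?_, ?_⟩
  · rw [hrange]
    exact isClosed_singleton.preimage (Semidirect.continuous_left (isInducing_leftRightχq p i j))
  · rintro _ ⟨σ, rfl⟩
    exact inr_mem_cuspDecomp (actχq p i j) (actχq_stabilises p i j) σ
  · rw [eq_bot_iff]
    rintro g ⟨⟨σ, rfl⟩, hI⟩
    have hI' : (SemidirectProduct.inr σ : PiTpχq p i j) ∈ (curveχq' p i j).inertia () := hI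
    rw [inertia_curveχq'_eq] at hI'
    obtain ⟨q, -, hq⟩ := hI'
    have : σ = 1 := by
      have h := congrArg SemidirectProduct.right hq
      simpa using h.symm
    rw [Subgroup.mem_bot, this, map_one]
  · apply le_antisymm
    · exact sup_le (by rintro _ ⟨σ, rfl⟩; exact inr_mem_cuspDecomp (actχq p i j) (actχq_stabilises p i j) σ)
        inf_le_left
    · intro g hg
      have hdec : (SemidirectProduct.inl g.left : PiTpχq p i j) * SemidirectProduct.inr g.right = g :=
        SemidirectProduct.inl_left_mul_inr_right g
      rw [← hdec]
      refine Subgroup.mul_mem _ (Subgroup.mem_sup_right ?_) (Subgroup.mem_sup_left ⟨g.right, rfl⟩)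
      change (SemidirectProduct.inl g.left : PiTpχq p i j) ∈ (curveχq' p i j).inertia ()
      rw [inertia_curveχq'_eq]
      exact ⟨g.left, hg, rfl⟩


/-! ### Appended (abc-iut-w5-d249): the `Γ`-level axis law for the affine group, and `rfl` transfers for consumers -/

/-- **The affine action moves the `b`-axis of `Γ` only through its cyclotomic part**, for ANY element of
`(Ẑ × Ẑ) ⋊ Ẑ^×`: `affTwist₃Gfp g (b^t, 0) = (b^{g.right t}, 0)`. [cite: MochizukiEtTh2009, §1 p.12] -/
theorem affTwist₃Gfp_bPowGfp (g : (ZH × ZH) ⋊[diagAut] MulAut ZH) (t : ZH) :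
    affTwist₃Gfp g (bPowGfp t) = bPowGfp (g.right t) :=
  Subtype.ext (Prod.ext (by
    change affTwist₃ g (bPow t) = bPow (g.right t)
    exact affTwist₃_bPow g t) rfl)

/-- Hence every `affTwist₃Gfp g` stabilises the `b`-axis of `Γ`. [cite: MochizukiEtTh2009, §1 p.12] -/
theorem affTwist₃Gfp_mem_bAxisGfp (g : (ZH × ZH) ⋊[diagAut] MulAut ZH) {q : Gfp} (hq : q ∈ bAxisGfp) :
    affTwist₃Gfp g q ∈ bAxisGfp := by
  obtain ⟨t, rfl⟩ := hq
  exact ⟨g.right t, (affTwist₃Gfp_bPowGfp g t).symm⟩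

/-- `curveχq′` and `curveχq` share the augmentation. [cite: MochizukiEtTh2009, §1 p.12] -/
theorem curveχq'_aug : (curveχq' p i j).aug = (curveχq p i j).aug := rfl

/-- … and the completion map. [cite: MochizukiEtTh2009, §1 p.12] -/
theorem curveχq'_toHat : (curveχq' p i j).toHat = (curveχq p i j).toHat := rfl

/-- … hence `Δ^tp`. [cite: MochizukiEtTh2009, §1 p.12] -/
theorem curveχq'_deltaTemp : (curveχq' p i j).DeltaTemp = (curveχq p i j).DeltaTemp := rfl

/-- `Π^tp` of `curveχq′` is tempered (= `isTempered_PiTpχq`). [cite: MochizukiEtTh2009, §1 p.12] -/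
theorem isTempered_piTemp_curveχq' : IsTempered (curveχq' p i j).PiTemp := isTempered_PiTpχq p i j

/-- `Δ_X` of `curveχq′` is profinite free on two generators. [cite: MochizukiEtTh2009, §1 p.12] -/
theorem isFreeProfiniteOnTwo_deltaHat_curveχq' : IsFreeProfiniteOnTwo (curveχq' p i j).DeltaHat :=
  isFreeProfiniteOnTwo_deltaHatχq p i j

/-- `curveχq′` HAS a cusp at its unique point. [cite: MochizukiEtTh2009, §1 p.12] -/
theorem isCusp_curveχq' (x : (curveχq' p i j).Pt) : (curveχq' p i j).IsCusp x := trivial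

/-- Non-vacuity bookkeeping: a `TemperedCurve p` with a closed point at stage 2. [cite: MochizukiSemiAnbd2006, §6 p.71] -/
theorem nonempty_pt_curveχq' : Nonempty (curveχq' p i j).Pt := ⟨()⟩

end Literature.AnabelianGeometry.EtaleTheta.SettingModel

end
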